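import Summits.HodgeConjecture.HodgeConjecture.Theorems.Ring2HypothesesMTAnchorsCMAnchored
import Literature.AlgebraicGeometry.Motives.CurveThroughTwoPointsNonSeparated
import HarnessLib

/-!
# Ring 2 — hypotheses layer: row b01 (`MumfordTateCMAnchors`) AS TYPED is its curve form

HONEST FRAMING: research route conditional on HC_CM; not a corollary; Q11.4-sentence-2 already refuted in dim ≥ 3.

Cell `pub-hodge-ring2`, binder-prover seat `ring2-b01` (gen 10), BINDER-OWNERS row b01
(`Ring2.Hypotheses.MumfordTateCMAnchors`: KIND CITE, kernel-bound `↔` the named fact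
`Abdulali1994.deligne1982_exists_cmAnchoredHodgeFamily`). `HC_CM` (`Theses.RankFourFaces.CMAbelianHodge`) does
not occur in this file; nothing here proves a case of the Hodge conjecture; no definition, no named fact, no
`sorry`.

## What this part adds

Gens 7–9 reduced row b01 to its curve form `MTAnchorsCurve[]` and identified it with `MTAnchorsSep[]` (the
binder with the base SEPARATED over `ℂ`) and with `MTFlatSep[]` (Charles–Schnell Thm. 11.5.11 (a) + flat (b) +
ONE CM point, separated base), leaving ONE residual between the binder AS TYPED and its curve form: the typing
artefact "smooth irreducible base NOT separated over `ℂ`" (the binder's `∃ (𝒳 S : SchemeOver ℂ) …` does not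
exclude such bases; Mumford's two-point lemma was available only for separated schemes). That residual is
CLOSED here by the tree THEOREM `Motives.mumford_smoothCurve_through_two_points_of_irreducibleSpace_of_smooth`
(`Literature/…/Motives/CurveThroughTwoPointsNonSeparated`, this seat: any two complex points of a smooth
irreducible `ℂ`-scheme — separated or not — lie in the image of a smooth irreducible affine curve; proof by the
closure-of-the-graph correspondence between projective compactifications of two affine charts and a gluing
lemma, `Motives/CurveThroughTwoPointsTwoCharts`):

* `curveAnchorsFor_of_flatSection_of_smooth` (ENGINE v3) — gen 8's engine v2 with the separatedness of the base
  DELETED; `curveAnchorsFor_of_globalClass_of_smooth`;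
* **`mtAnchorsCurve_of_mumfordTateCMAnchors : MumfordTateCMAnchors → MTAnchorsCurve[]`** and
  **`mumfordTateCMAnchors_iff_curve : MumfordTateCMAnchors ↔ MTAnchorsCurve[]`** — the binder AS TYPED is its
  curve form; hence `mumfordTateCMAnchors_iff_sep`, `mumfordTateCMAnchors_iff_flatSep`, and, with the
  non-separated flat form `MTFlat[]` (Thm. 11.5.11 (a) + flat (b) + one CM point over ANY smooth irreducible
  base), `mumfordTateCMAnchors_iff_flat`;
* **`mumfordTateCMAnchors_iff_cmAnchoredFamilies_of_raynaud1970_of_catanese2002 :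
  MumfordTateCMAnchors ↔ CMAnchoredFamilies`** modulo the two booked facts {c20 Raynaud 1970, c21 Catanese
  2002} — rows b01 and b07 are ONE ROW AS TYPED modulo those facts (gen 9 had this over separated bases only;
  deform part XX honest column (1) "the converse is not derivable as typed" is now: derivable modulo c20).

KIND of row b01 unchanged (CITE); «10 · 0» unchanged; no new binder; the typing question L44.15 (v) (whether to
add `IsSeparated`/quasi-projectivity to the binder) is thereby moot in the kernel: nothing is gained or lost.

Sources. [CharlesSchnell2014Notes] Thm. 11.5.11 and proof pp. 516–518; [Deligne1982HodgeCycles] Prop. 6.1;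
[MumfordAV1970] §6 Lemma; [GortzWedhorn2020] Thm. 13.100; [GortzWedhorn2023] Thm. 27.291 (= Raynaud 1970 XI 1.4);
[Catanese2002DeformationTypes] Thm. 4.1/4.6; [VoisinHodgeII2003] Thm. 4.18.
-/

-- every declaration of this problem lives in `Summit.HodgeConjecture.HodgeConjecture.…` (summit = sub-problem)
set_option linter.dupNamespace false

noncomputable section

open CategoryTheory AlgebraicGeometry Topology Filter
open Literature.AlgebraicGeometry Literature.AlgebraicGeometry.Motives Literature.AlgebraicGeometry.HodgeTheory
open Literature.AlgebraicGeometry.Deligne1982 (cmLocus deligne1982_cmDenseMumfordTateFamilies)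

namespace Summit.HodgeConjecture.HodgeConjecture.Ring2.Hypotheses

/-! ## §0 File-local notations (no definition is introduced)

`CurveAnchorsFor[A, p, c]`, `MTAnchorsCurve[]`, `MTAnchorsSep[]`, `MTFlatSep[]` are repeated byte for byte from
`Ring2HypothesesMTAnchorsSeparatedBase` (local notations do not cross files); `MTFlat[]` is new. -/

/-- `CurveAnchorsFor[A, p, c]` — the body of `MumfordTateCMAnchors` for the class `c ∈ H^{2p}(A(ℂ); ℂ)`, with the
base additionally AFFINE of topological Krull dimension `≤ 1` (verbatim the notation of
`Ring2HypothesesMTAnchorsOfFlatSections`). Local notation only. -/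
local notation3 (prettyPrint := false) "CurveAnchorsFor[" A ", " p ", " c "]" =>
  ∃ (𝒳 S : SchemeOver ℂ) (f : 𝒳 ⟶ S) (s₁ s₀ : ComplexPoints S) (e : AbelianVariety.X A ≅ fiberOver f s₁)
    (W : complexBetti 𝒳 (2 * p)) (A₀ : AbelianVariety ℂ),
    IsSmoothProjectiveFamily f (AbelianVariety.dim A) ∧ IrreducibleSpace S.left ∧
    AlgebraicGeometry.Smooth S.hom ∧ IsAffine S.left ∧ topologicalKrullDim S.left ≤ 1 ∧
    (∀ s : ComplexPoints S, ∃ A' : AbelianVariety ℂ,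
      A'.dim = AbelianVariety.dim A ∧ Nonempty (A'.X ≅ fiberOver f s)) ∧
    (∀ s : ComplexPoints S, IsRationalClass (complexBetti.map (fiberι f s) (2 * p) W) ∧
      IsOfHodgeType (AbelianVariety.dim A) (fiberOver f s) (2 * p) p p
        (complexBetti.map (fiberι f s) (2 * p) W)) ∧
    complexBetti.map e.hom (2 * p) (complexBetti.map (fiberι f s₁) (2 * p) W) = c ∧
    A₀.dim = AbelianVariety.dim A ∧ Nonempty (A₀.X ≅ fiberOver f s₀) ∧
    (∃ E : Subalgebra ℚ A₀.endAlgebra, IsReduced ↥E ∧ (∀ x ∈ E, ∀ y ∈ E, x * y = y * x) ∧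
      Module.finrank ℚ ↥E = 2 * A₀.dim)

/-- `MTAnchorsCurve[]` — `MumfordTateCMAnchors` OVER CURVE BASES (verbatim the notation of
`Ring2HypothesesMTAnchorsOfFlatSections`). Local notation only. -/
local notation3 (prettyPrint := false) "MTAnchorsCurve[]" =>
  ∀ (A : AbelianVariety ℂ), IsSmoothProjective A.dim A.X →
    ∀ (p : ℕ) (c : complexBetti A.X (2 * p)), IsRationalClass c →
      IsOfHodgeType A.dim A.X (2 * p) p p c → CurveAnchorsFor[A, p, c]

/-- `MTAnchorsSep[]` — the body of `MumfordTateCMAnchors` with the base SEPARATED over `ℂ` (verbatim gen 8's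
notation of `Ring2HypothesesMTAnchorsSeparatedBase`). Local notation only. -/
local notation3 (prettyPrint := false) "MTAnchorsSep[]" =>
  ∀ (A : AbelianVariety ℂ), IsSmoothProjective A.dim A.X →
    ∀ (p : ℕ) (c : complexBetti A.X (2 * p)), IsRationalClass c →
      IsOfHodgeType A.dim A.X (2 * p) p p c →
        ∃ (𝒳 S : SchemeOver ℂ) (f : 𝒳 ⟶ S) (s₁ s₀ : ComplexPoints S) (e : A.X ≅ fiberOver f s₁)
          (W : complexBetti 𝒳 (2 * p)) (A₀ : AbelianVariety ℂ),
          IsSmoothProjectiveFamily f A.dim ∧ IrreducibleSpace S.left ∧ AlgebraicGeometry.Smooth S.hom ∧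
          IsSeparated S.hom ∧
          (∀ s : ComplexPoints S, ∃ A' : AbelianVariety ℂ, A'.dim = A.dim ∧ Nonempty (A'.X ≅ fiberOver f s)) ∧
          (∀ s : ComplexPoints S, IsRationalClass (complexBetti.map (fiberι f s) (2 * p) W) ∧
            IsOfHodgeType A.dim (fiberOver f s) (2 * p) p p (complexBetti.map (fiberι f s) (2 * p) W)) ∧
          complexBetti.map e.hom (2 * p) (complexBetti.map (fiberι f s₁) (2 * p) W) = c ∧
          A₀.dim = A.dim ∧ Nonempty (A₀.X ≅ fiberOver f s₀) ∧
          (∃ E : Subalgebra ℚ A₀.endAlgebra, IsReduced ↥E ∧ (∀ x ∈ E, ∀ y ∈ E, x * y = y * x) ∧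
            Module.finrank ℚ ↥E = 2 * A₀.dim)

/-- `MTFlatSep[]` — Charles–Schnell Thm. 11.5.11 (a) with (b) in FLAT-SECTION form and ONE CM point, over a
smooth irreducible SEPARATED base (verbatim gen 8's notation). Local notation only. -/
local notation3 (prettyPrint := false) "MTFlatSep[]" =>
  ∀ (A : AbelianVariety ℂ), IsSmoothProjective A.dim A.X →
    ∀ (p : ℕ) (c : complexBetti A.X (2 * p)), IsRationalClass c →
      IsOfHodgeType A.dim A.X (2 * p) p p c →
        ∃ (𝒳 S : SchemeOver ℂ) (f : 𝒳 ⟶ S) (σ : ComplexPoints S → FiberClass f (2 * p))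
          (s₁ : ComplexPoints S) (e : A.X ≅ fiberOver f s₁) (s₀ : ComplexPoints S),
          IsSmoothProjectiveFamily f A.dim ∧ IrreducibleSpace S.left ∧ AlgebraicGeometry.Smooth S.hom ∧
          IsSeparated S.hom ∧
          (∀ s : ComplexPoints S, ∃ A' : AbelianVariety ℂ, A'.dim = A.dim ∧ Nonempty (A'.X ≅ fiberOver f s)) ∧
          Continuous σ ∧ (∀ s, (σ s).pt = s) ∧ (∀ s, σ s ∈ locusOfHodgeClasses f A.dim p) ∧
          σ s₁ = ⟨s₁, complexBetti.map e.inv (2 * p) c⟩ ∧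
          s₀ ∈ cmLocus f A.dim

/-- `MTFlat[]` — Charles–Schnell Thm. 11.5.11 (a) with (b) in FLAT-SECTION form and ONE CM point, over an
ARBITRARY smooth irreducible base (`MTFlatSep[]` with the separatedness clause deleted): a smooth projective
abelian-fibred family of relative dimension `dim A`, a continuous section `σ` of the espace étalé of `R^{2p}f_*ℂ`
valued in the locus of Hodge classes through `(s₁, (e⁻¹)^* c)`, and a point `s₀` of the CM locus. NEW local
notation; no definition. -/
local notation3 (prettyPrint := false) "MTFlat[]" =>
  ∀ (A : AbelianVariety ℂ), IsSmoothProjective A.dim A.X →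
    ∀ (p : ℕ) (c : complexBetti A.X (2 * p)), IsRationalClass c →
      IsOfHodgeType A.dim A.X (2 * p) p p c →
        ∃ (𝒳 S : SchemeOver ℂ) (f : 𝒳 ⟶ S) (σ : ComplexPoints S → FiberClass f (2 * p))
          (s₁ : ComplexPoints S) (e : A.X ≅ fiberOver f s₁) (s₀ : ComplexPoints S),
          IsSmoothProjectiveFamily f A.dim ∧ IrreducibleSpace S.left ∧ AlgebraicGeometry.Smooth S.hom ∧
          (∀ s : ComplexPoints S, ∃ A' : AbelianVariety ℂ, A'.dim = A.dim ∧ Nonempty (A'.X ≅ fiberOver f s)) ∧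
          Continuous σ ∧ (∀ s, (σ s).pt = s) ∧ (∀ s, σ s ∈ locusOfHodgeClasses f A.dim p) ∧
          σ s₁ = ⟨s₁, complexBetti.map e.inv (2 * p) c⟩ ∧
          s₀ ∈ cmLocus f A.dim

/-! ## §1 The engine over arbitrary smooth irreducible bases -/

section Engine

variable {A : AbelianVariety ℂ} {p : ℕ} {c : complexBetti A.X (2 * p)}

/-- **ENGINE v3 — curve anchors from a flat section over ANY smooth irreducible base.** Let `f : 𝒳 ⟶ S` be a
smooth projective abelian-fibred family of relative dimension `dim A` over a smooth irreducible `ℂ`-scheme `S`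
(NOT assumed separated or quasi-compact), `σ` a continuous section of the espace étalé of `R^{2p}f_*ℂ` valued in
the locus of Hodge classes with `e^*(σ(s₁)) = c`, and `s₀` ANY point of the CM locus. Then `CurveAnchorsFor[A, p, c]`:
Mumford's two-point lemma in its non-separated form (tree theorem
`Motives.mumford_smoothCurve_through_two_points_of_irreducibleSpace_of_smooth`) gives a smooth irreducible affine
curve `g : C ⟶ S` through `s₁` and `s₀` (also when `s₁ = s₀`), and gen 7's `curveAnchorsFor_of_curve` (base change;
the flat section over the curve is the global section of one class) concludes. NO named fact.
[cite: CharlesSchnell2014Notes, proof of Thm. 11.5.11 (pp. 517–518)] [cite: MumfordAV1970, §6 Lemma]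
[cite: VoisinHodgeII2003, Thm. 4.18] -/
theorem curveAnchorsFor_of_flatSection_of_smooth {𝒳 S : SchemeOver ℂ} (f : 𝒳 ⟶ S)
    (hf : IsSmoothProjectiveFamily f A.dim) [IrreducibleSpace S.left] [AlgebraicGeometry.Smooth S.hom]
    (hab : ∀ s : ComplexPoints S, ∃ A' : AbelianVariety ℂ, A'.dim = A.dim ∧ Nonempty (A'.X ≅ fiberOver f s))
    {σ : ComplexPoints S → FiberClass f (2 * p)} (hσ : Continuous σ) (hpt : ∀ s, (σ s).pt = s)
    (hH : ∀ s, σ s ∈ locusOfHodgeClasses f A.dim p) {s₁ s₀ : ComplexPoints S}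
    (he : ∃ e : A.X ≅ fiberOver f (σ s₁).pt, complexBetti.map e.hom (2 * p) (σ s₁).cls = c)
    (hs₀ : s₀ ∈ cmLocus f A.dim) : CurveAnchorsFor[A, p, c] := by
  obtain ⟨C, g, a', b', hCaff, hCirr, hCsm, hCdim, ha', hb'⟩ :=
    mumford_smoothCurve_through_two_points_of_irreducibleSpace_of_smooth s₁ s₀
  exact curveAnchorsFor_of_curve f hf hab hσ hpt hH he hs₀ g hCaff hCirr hCsm hCdim ha' hb'

/-- **Global-class form of engine v3**: a b01-type family (global class `W`) over ANY smooth irreducible base,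
with anchor `s₁` and CM point `s₀` anywhere, can be replaced by one over a smooth irreducible affine curve.
[cite: MumfordAV1970, §6 Lemma] [cite: CharlesSchnell2014Notes, Thm. 11.5.11] -/
theorem curveAnchorsFor_of_globalClass_of_smooth {𝒳 S : SchemeOver ℂ} (f : 𝒳 ⟶ S)
    (hf : IsSmoothProjectiveFamily f A.dim) [IrreducibleSpace S.left] [AlgebraicGeometry.Smooth S.hom]
    (hab : ∀ s : ComplexPoints S, ∃ A' : AbelianVariety ℂ, A'.dim = A.dim ∧ Nonempty (A'.X ≅ fiberOver f s))
    (W : complexBetti 𝒳 (2 * p))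
    (hW : ∀ s : ComplexPoints S, IsRationalClass (complexBetti.map (fiberι f s) (2 * p) W) ∧
      IsOfHodgeType A.dim (fiberOver f s) (2 * p) p p (complexBetti.map (fiberι f s) (2 * p) W))
    {s₁ s₀ : ComplexPoints S} (e : A.X ≅ fiberOver f s₁)
    (he : complexBetti.map e.hom (2 * p) (complexBetti.map (fiberι f s₁) (2 * p) W) = c)
    (hs₀ : s₀ ∈ cmLocus f A.dim) : CurveAnchorsFor[A, p, c] :=
  curveAnchorsFor_of_flatSection_of_smooth f hf hab (continuous_globalSection f (2 * p) W) (fun _ => rfl)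
    (fun s => globalSection_mem_locusOfHodgeClasses (hW s).1 (hW s).2) (s₁ := s₁) ⟨e, he⟩ hs₀

end Engine

/-! ## §2 The binder AS TYPED is its curve form -/

/-- **`MumfordTateCMAnchors ⟹ MTAnchorsCurve[]`** — a b01 family over an ARBITRARY smooth irreducible base
(anchor `s₁`, CM fibre at `s₀`, global class `W`) can be replaced by one over a smooth irreducible affine curve:
engine v3. Closes the last residual between the binder as typed and its curve form (gens 7–9).
[cite: CharlesSchnell2014Notes, Thm. 11.5.11] [cite: MumfordAV1970, §6 Lemma] -/
theorem mtAnchorsCurve_of_mumfordTateCMAnchors (h : MumfordTateCMAnchors) : MTAnchorsCurve[] := by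
  intro A hA p c hc hpp
  obtain ⟨𝒳, S, f, s₁, s₀, e, W, A₀, hf, hirr, hsm, hab, hW, hWc, hdim₀, he₀, hcm₀⟩ := h A hA p c hc hpp
  haveI := hirr
  haveI := hsm
  exact curveAnchorsFor_of_globalClass_of_smooth f hf hab W hW e hWc ⟨A₀, he₀, hdim₀, hcm₀⟩

/-- **Row b01 AS TYPED is its curve form: `MumfordTateCMAnchors ↔ MTAnchorsCurve[]`** (with gen 7's
`mumfordTateCMAnchors_of_curve`). [cite: CharlesSchnell2014Notes, Thm. 11.5.11] [cite: MumfordAV1970, §6 Lemma] -/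
theorem mumfordTateCMAnchors_iff_curve : MumfordTateCMAnchors ↔ MTAnchorsCurve[] :=
  ⟨mtAnchorsCurve_of_mumfordTateCMAnchors, mumfordTateCMAnchors_of_curve⟩

/-- **`MumfordTateCMAnchors ↔ MTAnchorsSep[]`**: adding `IsSeparated S.hom` to the binder's typing changes nothing
(gen 8's `mtAnchorsCurve_iff_sep`). [cite: CharlesSchnell2014Notes, Thm. 11.5.11] [cite: MumfordAV1970, §6 Lemma] -/
theorem mumfordTateCMAnchors_iff_sep : MumfordTateCMAnchors ↔ MTAnchorsSep[] :=
  mumfordTateCMAnchors_iff_curve.trans mtAnchorsCurve_iff_sep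

/-- **`MumfordTateCMAnchors ↔ MTFlatSep[]`**: the binder as typed ⟺ Charles–Schnell Thm. 11.5.11 (a) + flat (b) +
one CM point over a separated base (gen 8's `mtAnchorsCurve_iff_flatSep`).
[cite: CharlesSchnell2014Notes, Thm. 11.5.11 (a)(b) and proof] -/
theorem mumfordTateCMAnchors_iff_flatSep : MumfordTateCMAnchors ↔ MTFlatSep[] :=
  mumfordTateCMAnchors_iff_curve.trans mtAnchorsCurve_iff_flatSep

/-- **`MTFlat[] ⟹ MTAnchorsCurve[]`** — Thm. 11.5.11 (a) + flat (b) + ONE CM point over ANY smooth irreducible base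
gives the curve form of row b01 (engine v3). [cite: CharlesSchnell2014Notes, Thm. 11.5.11 (a)(b) and proof] -/
theorem mtAnchorsCurve_of_flat (h : MTFlat[]) : MTAnchorsCurve[] := by
  intro A hA p c hc hpp
  obtain ⟨𝒳, S, f, σ, s₁, e, s₀, hf, hirr, hsm, hab, hσ, hpt, hH, he, hs₀⟩ := h A hA p c hc hpp
  haveI := hirr
  haveI := hsm
  exact curveAnchorsFor_of_flatSection_of_smooth f hf hab hσ hpt hH (exists_anchor_of_eq_mk f e c he) hs₀

/-- `MTFlatSep[] ⟹ MTFlat[]` (forget separatedness). [folklore] -/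
theorem mtFlat_of_flatSep (h : MTFlatSep[]) : MTFlat[] := by
  intro A hA p c hc hpp
  obtain ⟨𝒳, S, f, σ, s₁, e, s₀, hf, hirr, hsm, -, hab, hσ, hpt, hH, he, hs₀⟩ := h A hA p c hc hpp
  exact ⟨𝒳, S, f, σ, s₁, e, s₀, hf, hirr, hsm, hab, hσ, hpt, hH, he, hs₀⟩

/-- **`MumfordTateCMAnchors ↔ MTFlat[]`** — the binder as typed ⟺ Charles–Schnell Thm. 11.5.11 (a) + flat (b) +
ONE CM point over ANY smooth irreducible base: neither the global invariant cycle theorem, nor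
quasi-projectivity, nor separatedness, nor the density of CM points is a kernel input of row b01.
[cite: CharlesSchnell2014Notes, Thm. 11.5.11 and proof (pp. 516–518)] [cite: Deligne1982HodgeCycles, Prop. 6.1] -/
theorem mumfordTateCMAnchors_iff_flat : MumfordTateCMAnchors ↔ MTFlat[] :=
  ⟨fun h => mtFlat_of_flatSep (mumfordTateCMAnchors_iff_flatSep.mp h),
    fun h => mumfordTateCMAnchors_of_curve (mtAnchorsCurve_of_flat h)⟩

/-! ## §3 Rows b01 and b07 AS TYPED are one row modulo {Raynaud 1970, Catanese 2002} -/

/-- **`MumfordTateCMAnchors ⟹ CMAnchoredFamilies` modulo Raynaud 1970** — row b07 from row b01 AS TYPED (gen 9's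
`cmAnchoredFamilies_of_mtAnchorsSep_of_raynaud1970` after `mumfordTateCMAnchors_iff_sep`): the converse of deform
part XX (C), recorded there as "not derivable as typed", is derivable modulo the booked fact c20. CONDITIONAL on
`raynaud1970_abelianScheme_section_projective` (hypothesis `hR`, not discharged).
[cite: GortzWedhorn2023, §(27.53) Thm. 27.291] [cite: LaurentSchroer2023, §4 Prop. 4.3] [cite: MumfordAV1970, §6 Lemma] -/
theorem cmAnchoredFamilies_of_mumfordTateCMAnchors_of_raynaud1970
    (hR : raynaud1970_abelianScheme_section_projective) (h : MumfordTateCMAnchors) : CMAnchoredFamilies :=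
  cmAnchoredFamilies_of_mtAnchorsSep_of_raynaud1970 hR (mumfordTateCMAnchors_iff_sep.mp h)

/-- **Rows b01 and b07 are ONE ROW AS TYPED modulo the booked facts {Raynaud 1970, Catanese 2002}:
`MumfordTateCMAnchors ↔ CMAnchoredFamilies`.** CONDITIONAL on both named facts (hypotheses; neither discharged).
[cite: GortzWedhorn2023, §(27.53) Thm. 27.291] [cite: Catanese2002DeformationTypes, Thm. 4.1 and Thm. 4.6]
[cite: Deligne1982HodgeCycles, Prop. 6.1] -/
theorem mumfordTateCMAnchors_iff_cmAnchoredFamilies_of_raynaud1970_of_catanese2002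
    (hR : raynaud1970_abelianScheme_section_projective) (hCat : catanese2002_abelianFibres_of_abelianFibre) :
    MumfordTateCMAnchors ↔ CMAnchoredFamilies :=
  mumfordTateCMAnchors_iff_sep.trans (mtAnchorsSep_iff_cmAnchoredFamilies_of_raynaud1970_of_catanese2002 hR hCat)

/-! ## Audit

No definition, no named fact, no `sorry`; `HC_CM` does not occur. The five notations are file-local. Every
theorem concluding `MumfordTateCMAnchors` / `MTAnchorsCurve[]` / `CMAnchoredFamilies` carries a displayed
hypothesis — a REDUCTION of the rows' printed input, crediting nothing; the engine is hypothesis-free mathematics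
(Mumford's lemma in its non-separated form, Chow's correspondence and the curve-base partie fixe are tree
THEOREMS). Axiom closures: the three standard axioms only. -/

#print axioms Summit.HodgeConjecture.HodgeConjecture.Ring2.Hypotheses.mumfordTateCMAnchors_iff_curve
#print axioms Summit.HodgeConjecture.HodgeConjecture.Ring2.Hypotheses.mumfordTateCMAnchors_iff_flat
#print axioms Summit.HodgeConjecture.HodgeConjecture.Ring2.Hypotheses.mumfordTateCMAnchors_iff_cmAnchoredFamilies_of_raynaud1970_of_catanese2002

end Summit.HodgeConjecture.HodgeConjecture.Ring2.Hypotheses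

end
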